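import Summits.ResolutionOfSingularities.ResolutionOfSingularities.Theorems.FrobeniusLadderFInjectiveMacaulayficationDiagonalBPTripleSpecimen
import Summits.ResolutionOfSingularities.ResolutionOfSingularities.Theorems.FrobeniusLadderFInjectiveMacaulayficationCIClassRowEqualSupport
import Summits.ResolutionOfSingularities.ResolutionOfSingularities.Theorems.FrobeniusLadderFInjectiveMacaulayficationDiagonalBPCIVertexNotFull
import Mathlib.FieldTheory.IsAlgClosed.AlgebraicClosure
import HarnessLib

/-!
# ★★★ ROW #12 = BED CI-2 (codimension THREE, dimension 4): the diagonal Brieskorn–Pham TRIPLE `X = V(F₀, F₁, F₂) ⊂ 𝔸⁷`, `F_l = Σᵢ c_{l,i}xᵢ^{aᵢ}`, `a = (2,3,5,3,4,7,7)`,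
# rows `(1,…,1), (1,…,7), (1,4,…,49)` — POINT FLOOR CURED (`p ≥ 11`, ANY field) and the vertex NOT FULL (every `p` with `2 ≠ 0`)
# (crux `FInjectiveMacaulayfication` stmt-ResolutionOfSingularities-15315, chain w45a; res-L1-w45a-plan-1 RULING R23.22 (β) «a second equal-support bed of different codimension»;
# seat res-L1-w45a-stub-2 g13)

[OURS · L1 W4.5a] Support file (`--supports stmt-ResolutionOfSingularities-15315 --as helper`); def-free; UNCONDITIONAL; no named fact, no sorry; NOT a statement of any
manuscript; replaces the role of NO printed item. Nothing of the crux is proved: a census row is a certificate on ONE bed. AI-written (AI review weaker than expert review).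

* §1 ★★★ `diagonalBPTriple_pointFloorCured` (`p ≥ 11`, `K ⊇ k` algebraically closed carries the geometric non-degeneracy): for EVERY blowing up `S′ → Spec 𝒪_{X,v}` of the POINT
  FLOOR there is `𝓚 ≠ ⊥` on `S′`, supported over the closed point, ALL of whose blowings up are FULL at EVERY stalk — ONE application of the unconditional CI class theorem
  ✓ `CIClassRowEqualSupport.fHalfRow_CI_of_convenient_equalSupport` (`r = 3`) with the class hypotheses of ✓ `DiagonalBPTripleSpecimen` / ✓ `DiagonalCITriple`.
* §2 ★ `diagonalBPTriple_vertex_not_full` (every prime `p` with `2 ≠ 0` in `k`): `¬ FullCl p (𝒪_{X,v})` — the CI Fedder criterion, necessity (✓ `CINotFullAtMaximalIdeal.ci_not_fullCl_stalk_origin`):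
  `(F₀F₁F₂)^{p−1} ∈ 𝔪^{[p]}` by the weighted pigeonhole with `w = (210,140,84,140,105,60,60)` (each `F_l` of weight `420`; `1260 > 799 = Σwᵢ`), expected dimension from
  `(x)⁸ ⊆ (F₀,F₁,F₂,x₃,…,x₆)` (`x₀², x₁³, x₂⁵` lie in it — `2` a unit).
* §3 ★★★ `row12_CI2_germ` — the registrar pairing `¬ FullCl p 𝒪_{X,v} ∧ (point floor CURED)` for `p ≥ 11`, `K := AlgebraicClosure k`.
[cite: Fedder1983, Thm. 1.12 and Prop. 2.1] [cite: IshiiSingularities2018, Thm. 4.4.23] [cite: CuetoPopescupampuStepanov2023, Def. 4.2] [cite: StacksProject, Tag 080A]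
-/

-- single-problem summit: the doubled namespace component is forced
set_option linter.dupNamespace false

noncomputable section

open AlgebraicGeometry CategoryTheory Literature.AlgebraicGeometry.Resolution TopologicalSpace IsLocalRing MvPolynomial

namespace Summit.ResolutionOfSingularities.ResolutionOfSingularities.Theorems.FInjectiveMacaulayfication.DiagonalBPTripleRow

open Summit.ResolutionOfSingularities.ResolutionOfSingularities.Theorems.FInjectiveMacaulayfication
open Literature.AlgebraicGeometry.Resolution.BoubakriGreuelMarkwig CINondegenerate SliceableCentre DiagonalBPTripleSpecimen

/-! ## §1 ★★★ The point floor is CURED -/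

set_option maxHeartbeats 1600000 in
-- the interface of the class theorem is large; the certificates are assembled in one term
/-- ★★★ **THE DIAGONAL BRIESKORN–PHAM CI TRIPLE IN `𝔸⁷` (codim 3, dim 4), `char k = p ≥ 11`, `k` ANY FIELD: POINT FLOOR CURED.** [OURS · census row over the unconditional CI class
theorem; cite: IshiiSingularities2018, Thm. 4.4.23; CuetoPopescupampuStepanov2023, Def. 4.2; StacksProject, Tag 080A] -/
theorem diagonalBPTriple_pointFloorCured (p : ℕ) [Fact p.Prime] (hp : 11 ≤ p) (k : Type) [Field k] [CharP k p] (K : Type) [Field K] [Algebra k K] [IsAlgClosed K]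
    (F : Fin 3 → MvPolynomial (Fin 7) k)
    (hF0 : F 0 = X 0 ^ 2 + X 1 ^ 3 + X 2 ^ 5 + X 3 ^ 3 + X 4 ^ 4 + X 5 ^ 7 + X 6 ^ 7)
    (hF1 : F 1 = X 0 ^ 2 + C 2 * X 1 ^ 3 + C 3 * X 2 ^ 5 + C 4 * X 3 ^ 3 + C 5 * X 4 ^ 4 + C 6 * X 5 ^ 7 + C 7 * X 6 ^ 7)
    (hF2 : F 2 = X 0 ^ 2 + C 4 * X 1 ^ 3 + C 9 * X 2 ^ 5 + C 16 * X 3 ^ 3 + C 25 * X 4 ^ 4 + C 36 * X 5 ^ 7 + C 49 * X 6 ^ 7)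
    (v : Spec (.of (MvPolynomial (Fin 7) k ⧸ Ideal.span (Set.range F))))
    (hvm : v.asIdeal = Ideal.span (Set.range fun j : Fin 7 => Ideal.Quotient.mk (Ideal.span (Set.range F)) (X j))) :
    ∀ (S' : Scheme.{0}) (gS : S' ⟶ Spec ((Spec (.of (MvPolynomial (Fin 7) k ⧸ Ideal.span (Set.range F)))).presheaf.stalk v)),
      IsBlowup gS ((affineBlowup.idealSheaf (Ideal.span (Set.range fun j : Fin 7 => Ideal.Quotient.mk (Ideal.span (Set.range F)) (X j)))).comap
        ((Spec (.of (MvPolynomial (Fin 7) k ⧸ Ideal.span (Set.range F)))).fromSpecStalk v)) →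
      ∃ 𝓚 : S'.IdealSheafData, 𝓚 ≠ ⊥ ∧
        (∀ s ∈ (𝓚.support : Set S'), gS.base s = closedPoint ((Spec (.of (MvPolynomial (Fin 7) k ⧸ Ideal.span (Set.range F)))).presheaf.stalk v)) ∧
        ∀ (S'' : Scheme.{0}) (π : S'' ⟶ S'), IsBlowup π 𝓚 → ∀ s : S'', FullCl p (S''.presheaf.stalk s) := by
  classical
  haveI : CharP K p := charP_of_injective_algebraMap (algebraMap k K).injective p
  obtain ⟨hak, hc₁k, hc₂k⟩ := casts k p hp
  obtain ⟨haK, hc₁K, hc₂K⟩ := casts K p hp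
  obtain ⟨hF0', hF1', hF2'⟩ := F_eq_sum k F hF0 hF1 hF2
  obtain ⟨hminor2k, hminor3k⟩ := minors k p hp
  obtain ⟨hminor2K, hminor3K⟩ := minors K p hp
  set a : Fin 7 → ℕ := ![2, 3, 5, 3, 4, 7, 7] with ha_def
  have ha : ∀ i, a i ≠ 0 := fun i => (hak i).1
  have ha2 : ∀ i, 2 ≤ a i := fun i => (hak i).2.1
  have hc₀ : ∀ i : Fin 7, (fun _ : Fin 7 => (1 : k)) i ≠ 0 := fun _ => one_ne_zero
  have hc₀K : ∀ i : Fin 7, (fun _ : Fin 7 => (1 : K)) i ≠ 0 := fun _ => one_ne_zero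
  have h2 : (2 : k) ≠ 0 := by exact_mod_cast DiagonalBPCIRow.natCast_ne_zero_of_lt (R := k) p 2 (by norm_num) (by omega)
  have h3 : (3 : k) ≠ 0 := by exact_mod_cast DiagonalBPCIRow.natCast_ne_zero_of_lt (R := k) p 3 (by norm_num) (by omega)
  -- base change of the triple to `K`
  have hmap0 : map (algebraMap k K) (F 0) = ∑ i : Fin 7, monomial (Finsupp.single i (a i)) ((fun _ : Fin 7 => (1 : K)) i) := by
    rw [hF0', DiagonalCIPair.map_diag]; simp only [map_one]
  have hmap1 : map (algebraMap k K) (F 1) = ∑ i : Fin 7, monomial (Finsupp.single i (a i)) ((fun i : Fin 7 => (((i : ℕ) + 1 : ℕ) : K)) i) := by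
    rw [hF1', DiagonalCIPair.map_diag]; simp only [map_natCast]
  have hmap2 : map (algebraMap k K) (F 2) = ∑ i : Fin 7, monomial (Finsupp.single i (a i)) ((fun i : Fin 7 => ((((i : ℕ) + 1) ^ 2 : ℕ) : K)) i) := by
    rw [hF2', DiagonalCIPair.map_diag]; simp only [map_natCast]
  -- the class hypotheses
  have hprime : (Ideal.span (Set.range F)).IsPrime := isPrime_span_triple k F hF0 hF1 hF2 h2 h3
  have hconv : ∀ j : Fin 7, ∃ N : ℕ, 0 < N ∧ MvPolynomial.coeff (Finsupp.single j N) (F 0) ≠ 0 := by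
    rw [hF0']; exact DiagonalCIPair.convenient_diag a ha _ hc₀
  have hsupp : ∀ l : Fin 3, (F l).support = (F 0).support := by
    intro l
    fin_cases l
    · rfl
    · simp only [Fin.mk_one]; rw [hF1', hF0']; exact DiagonalCIPair.support_diag_eq a ha _ _ hc₀ hc₁k
    · simp only [Fin.reduceFinMk]; rw [hF2', hF0']; exact DiagonalCIPair.support_diag_eq a ha _ _ hc₀ hc₂k
  have hND : ∀ w : Fin 7 → ℝ, (∀ i, 0 < w i) →
      IsCINondegenerateAlong w (fun l => ((map (algebraMap k K) (F l) : MvPolynomial (Fin 7) K) : MvPowerSeries (Fin 7) K)) :=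
    DiagonalCITriple.ciNondegenerate_triple (by norm_num) a ha (fun i => (haK i).2.2) _ _ _ hc₀K hc₁K hc₂K hminor2K hminor3K
      (fun l => map (algebraMap k K) (F l)) hmap0 hmap1 hmap2
  have hXne : ∀ v : Fin 7, Ideal.Quotient.mk (Ideal.span (Set.range F)) (X v) ≠ 0 := DiagonalCITriple.mk_X_ne_zero_triple a ha2 _ _ _ F hF0' hF1' hF2'
  have hreg : ∀ x : Spec (.of (MvPolynomial (Fin 7) k ⧸ Ideal.span (Set.range F))),
      ¬ Ideal.span (Set.range fun j : Fin 7 => Ideal.Quotient.mk (Ideal.span (Set.range F)) (X j)) ≤ x.asIdeal →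
        IsRegularLocalRing (Localization.AtPrime x.asIdeal) :=
    fun x hx => DiagonalCITriple.isRegularLocalRing_off_vertex_triple p a ha (fun i => (hak i).2.2) _ _ _ hc₀ hminor2k hminor3k F hF0' hF1' hF2' x.asIdeal hx
  exact CIClassRowEqualSupport.fHalfRow_CI_of_convenient_equalSupport p k K (by norm_num) F hprime 0 hconv hsupp hND hXne hreg v hvm

/-! ## §2 ★ The vertex is NOT FULL (p-uniform CI Fedder certificate) -/

section Fedder

variable (k : Type) [Field k] (F : Fin 3 → MvPolynomial (Fin 7) k)
  (hF0 : F 0 = X 0 ^ 2 + X 1 ^ 3 + X 2 ^ 5 + X 3 ^ 3 + X 4 ^ 4 + X 5 ^ 7 + X 6 ^ 7)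
  (hF1 : F 1 = X 0 ^ 2 + C 2 * X 1 ^ 3 + C 3 * X 2 ^ 5 + C 4 * X 3 ^ 3 + C 5 * X 4 ^ 4 + C 6 * X 5 ^ 7 + C 7 * X 6 ^ 7)
  (hF2 : F 2 = X 0 ^ 2 + C 4 * X 1 ^ 3 + C 9 * X 2 ^ 5 + C 16 * X 3 ^ 3 + C 25 * X 4 ^ 4 + C 36 * X 5 ^ 7 + C 49 * X 6 ^ 7)
include hF0 hF1 hF2

/-- `F₀, F₁, F₂` are weighted-homogeneous of weight `420` for `w = (210, 140, 84, 140, 105, 60, 60)`. [folklore] -/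
theorem isWeightedHomogeneous_F : ∀ l : Fin 3, IsWeightedHomogeneous (![210, 140, 84, 140, 105, 60, 60] : Fin 7 → ℕ) (F l) 420 := by
  have hX : ∀ (i : Fin 7) (e D : ℕ), e * (![210, 140, 84, 140, 105, 60, 60] : Fin 7 → ℕ) i = D →
      IsWeightedHomogeneous (![210, 140, 84, 140, 105, 60, 60] : Fin 7 → ℕ) ((X i : MvPolynomial (Fin 7) k) ^ e) D :=
    fun i e D h => DiagonalBPCIVertexNotFull.isWeightedHomogeneous_X_pow k _ i e D h
  have h0 := hX 0 2 420 (by decide)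
  have h1 := hX 1 3 420 (by decide)
  have h2 := hX 2 5 420 (by decide)
  have h3 := hX 3 3 420 (by decide)
  have h4 := hX 4 4 420 (by decide)
  have h5 := hX 5 7 420 (by decide)
  have h6 := hX 6 7 420 (by decide)
  intro l
  fin_cases l
  · simp only [Fin.zero_eta]; rw [hF0]
    exact (((((h0.add h1).add h2).add h3).add h4).add h5).add h6
  · simp only [Fin.mk_one]; rw [hF1]
    exact (((((h0.add (h1.C_mul 2)).add (h2.C_mul 3)).add (h3.C_mul 4)).add (h4.C_mul 5)).add (h5.C_mul 6)).add (h6.C_mul 7)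
  · simp only [Fin.reduceFinMk]; rw [hF2]
    exact (((((h0.add (h1.C_mul 4)).add (h2.C_mul 9)).add (h3.C_mul 16)).add (h4.C_mul 25)).add (h5.C_mul 36)).add (h6.C_mul 49)

/-- ★ **THE p-UNIFORM CI FEDDER CERTIFICATE OF THE VERTEX**: `(F₀F₁F₂)^{p−1} ∈ (x₀^p, …, x₆^p)` for EVERY `p ≥ 2` (`1260(p−1) > 799(p−1)`; `Σ 1/aᵢ < 3`).
[OURS · certificate; cite: Fedder1983, Prop. 2.1] -/
theorem prod_pow_mem_span_X_pow (p : ℕ) (hp : 2 ≤ p) :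
    (∏ l, F l) ^ (p - 1) ∈ Ideal.span (Set.range fun i : Fin 7 => (X i : MvPolynomial (Fin 7) k) ^ p) := by
  rw [Fin.prod_univ_three]
  have hw : IsWeightedHomogeneous (![210, 140, 84, 140, 105, 60, 60] : Fin 7 → ℕ) ((F 0 * F 1 * F 2) ^ (p - 1)) ((p - 1) • (420 + 420 + 420)) :=
    (((isWeightedHomogeneous_F k F hF0 hF1 hF2 0).mul (isWeightedHomogeneous_F k F hF0 hF1 hF2 1)).mul (isWeightedHomogeneous_F k F hF0 hF1 hF2 2)).pow (p - 1)
  refine DiagonalBPCIVertexNotFull.mem_span_X_pow_of_isWeightedHomogeneous k p _ _ _ hw ?_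
  have hsum : ∑ i : Fin 7, (![210, 140, 84, 140, 105, 60, 60] : Fin 7 → ℕ) i = 799 := by decide
  rw [hsum, smul_eq_mul]
  omega

/-- `F₀, F₁, F₂` vanish at the origin. [plumbing] -/
theorem constantCoeff_F : ∀ l : Fin 3, constantCoeff (F l) = 0 := by
  intro l
  fin_cases l
  · simp only [Fin.zero_eta]; rw [hF0]; simp [constantCoeff_X]
  · simp only [Fin.mk_one]; rw [hF1]; simp [constantCoeff_X]
  · simp only [Fin.reduceFinMk]; rw [hF2]; simp [constantCoeff_X]

/-- ★ **THE S.O.P. CERTIFICATE** (`2 ≠ 0` in `k`): `(x₀, …, x₆)⁸ ⊆ (F₀, F₁, F₂, x₃, x₄, x₅, x₆)` — `x₁³ = −3F₀ + 4F₁ − F₂ + (…)`, `2x₀² = 6F₀ − 5F₁ + F₂ − (…)`, `2x₂⁵ = 2F₀ − 3F₁ + F₂ − (…)`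
modulo `(x₃, …, x₆)`, and a monomial of degree `8` is divisible by one of `x₃, …, x₆, x₀², x₁³, x₂⁵`. [OURS · certificate; folklore] -/
theorem sop_certificate (h2 : (2 : k) ≠ 0) :
    Ideal.span (Set.range (X : Fin 7 → MvPolynomial (Fin 7) k)) ^ 8 ≤ Ideal.ofList (List.ofFn F ++ [X 3, X 4, X 5, X 6]) := by
  set J : Ideal (MvPolynomial (Fin 7) k) := Ideal.ofList (List.ofFn F ++ [X 3, X 4, X 5, X 6]) with hJ
  have hmem : ∀ x ∈ List.ofFn F ++ [X 3, X 4, X 5, X 6], x ∈ J := fun x hx => Ideal.subset_span hx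
  have hF0J : F 0 ∈ J := hmem _ (List.mem_append.mpr (Or.inl ((List.mem_ofFn' _ _).mpr ⟨0, rfl⟩)))
  have hF1J : F 1 ∈ J := hmem _ (List.mem_append.mpr (Or.inl ((List.mem_ofFn' _ _).mpr ⟨1, rfl⟩)))
  have hF2J : F 2 ∈ J := hmem _ (List.mem_append.mpr (Or.inl ((List.mem_ofFn' _ _).mpr ⟨2, rfl⟩)))
  have hX3 : (X 3 : MvPolynomial (Fin 7) k) ∈ J := hmem _ (by simp)
  have hX4 : (X 4 : MvPolynomial (Fin 7) k) ∈ J := hmem _ (by simp)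
  have hX5 : (X 5 : MvPolynomial (Fin 7) k) ∈ J := hmem _ (by simp)
  have hX6 : (X 6 : MvPolynomial (Fin 7) k) ∈ J := hmem _ (by simp)
  -- the tail `x₃, …, x₆`-part of any combination lies in `J`
  have htail : ∀ (u₃ u₄ u₅ u₆ : MvPolynomial (Fin 7) k), u₃ * X 3 + u₄ * X 4 + u₅ * X 5 + u₆ * X 6 ∈ J := fun u₃ u₄ u₅ u₆ =>
    add_mem (add_mem (add_mem (J.mul_mem_left _ hX3) (J.mul_mem_left _ hX4)) (J.mul_mem_left _ hX5)) (J.mul_mem_left _ hX6)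
  have hX1 : (X 1 : MvPolynomial (Fin 7) k) ^ 3 ∈ J := by
    have e : (X 1 : MvPolynomial (Fin 7) k) ^ 3 = -(C 3 * F 0) + C 4 * F 1 - F 2 +
        ((C 3 * X 3 ^ 2) * X 3 + (C 8 * X 4 ^ 3) * X 4 + (C 15 * X 5 ^ 6) * X 5 + (C 24 * X 6 ^ 6) * X 6) := by
      rw [hF0, hF1, hF2]; simp only [map_ofNat]; ring
    rw [e]
    exact add_mem (sub_mem (add_mem (neg_mem (J.mul_mem_left _ hF0J)) (J.mul_mem_left _ hF1J)) hF2J) (htail _ _ _ _)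
  have h22 : (C (2⁻¹ : k) : MvPolynomial (Fin 7) k) * 2 = 1 := by
    rw [show (2 : MvPolynomial (Fin 7) k) = C 2 by simp only [map_ofNat], ← map_mul, inv_mul_cancel₀ h2, map_one]
  have hX0 : (X 0 : MvPolynomial (Fin 7) k) ^ 2 ∈ J := by
    have e : (X 0 : MvPolynomial (Fin 7) k) ^ 2 = C (2⁻¹) * ((C 6 * F 0 - C 5 * F 1 + F 2) +
        ((-(C 2 * X 3 ^ 2)) * X 3 + (-(C 6 * X 4 ^ 3)) * X 4 + (-(C 12 * X 5 ^ 6)) * X 5 + (-(C 20 * X 6 ^ 6)) * X 6)) := by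
      rw [hF0, hF1, hF2]; simp only [map_ofNat]
      linear_combination (-(X 0 ^ 2 : MvPolynomial (Fin 7) k)) * h22
    rw [e]
    exact J.mul_mem_left _ (add_mem (add_mem (sub_mem (J.mul_mem_left _ hF0J) (J.mul_mem_left _ hF1J)) hF2J) (htail _ _ _ _))
  have hX2 : (X 2 : MvPolynomial (Fin 7) k) ^ 5 ∈ J := by
    have e : (X 2 : MvPolynomial (Fin 7) k) ^ 5 = C (2⁻¹) * ((C 2 * F 0 - C 3 * F 1 + F 2) +
        ((-(C 6 * X 3 ^ 2)) * X 3 + (-(C 12 * X 4 ^ 3)) * X 4 + (-(C 20 * X 5 ^ 6)) * X 5 + (-(C 30 * X 6 ^ 6)) * X 6)) := by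
      rw [hF0, hF1, hF2]; simp only [map_ofNat]
      linear_combination (-(X 2 ^ 5 : MvPolynomial (Fin 7) k)) * h22
    rw [e]
    exact J.mul_mem_left _ (add_mem (add_mem (sub_mem (J.mul_mem_left _ hF0J) (J.mul_mem_left _ hF1J)) hF2J) (htail _ _ _ _))
  -- every monomial of degree 8 lies in `J`
  rw [show Ideal.span (Set.range (X : Fin 7 → MvPolynomial (Fin 7) k)) = idealOfVars (Fin 7) k from rfl, pow_idealOfVars_eq_span, Ideal.span_le]
  rintro _ ⟨m, hm, rfl⟩
  rw [Set.mem_preimage, Set.mem_singleton_iff, Finsupp.degree_eq_sum, Fin.sum_univ_seven] at hm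
  change monomial m (1 : k) ∈ J
  by_cases h3 : 1 ≤ m 3
  · exact DiagonalBPCIVertexNotFull.monomial_mem_of_le k 3 1 m h3 (by rw [pow_one]; exact hX3)
  by_cases h4 : 1 ≤ m 4
  · exact DiagonalBPCIVertexNotFull.monomial_mem_of_le k 4 1 m h4 (by rw [pow_one]; exact hX4)
  by_cases h5 : 1 ≤ m 5
  · exact DiagonalBPCIVertexNotFull.monomial_mem_of_le k 5 1 m h5 (by rw [pow_one]; exact hX5)
  by_cases h6 : 1 ≤ m 6
  · exact DiagonalBPCIVertexNotFull.monomial_mem_of_le k 6 1 m h6 (by rw [pow_one]; exact hX6)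
  by_cases h0 : 2 ≤ m 0
  · exact DiagonalBPCIVertexNotFull.monomial_mem_of_le k 0 2 m h0 hX0
  by_cases h1 : 3 ≤ m 1
  · exact DiagonalBPCIVertexNotFull.monomial_mem_of_le k 1 3 m h1 hX1
  · exact DiagonalBPCIVertexNotFull.monomial_mem_of_le k 2 5 m (by omega) hX2

end Fedder

/-- ★ **BED CI-2, INPUT COLUMN: the vertex is NOT a FULL point — for EVERY prime `p` with `2 ≠ 0` in `k`, EVERY field.** [OURS · census certificate; cite: Fedder1983, Thm. 1.12 and Prop. 2.1] -/
theorem diagonalBPTriple_vertex_not_full (p : ℕ) [Fact p.Prime] (k : Type) [Field k] [CharP k p] (h2 : (2 : k) ≠ 0)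
    (F : Fin 3 → MvPolynomial (Fin 7) k)
    (hF0 : F 0 = X 0 ^ 2 + X 1 ^ 3 + X 2 ^ 5 + X 3 ^ 3 + X 4 ^ 4 + X 5 ^ 7 + X 6 ^ 7)
    (hF1 : F 1 = X 0 ^ 2 + C 2 * X 1 ^ 3 + C 3 * X 2 ^ 5 + C 4 * X 3 ^ 3 + C 5 * X 4 ^ 4 + C 6 * X 5 ^ 7 + C 7 * X 6 ^ 7)
    (hF2 : F 2 = X 0 ^ 2 + C 4 * X 1 ^ 3 + C 9 * X 2 ^ 5 + C 16 * X 3 ^ 3 + C 25 * X 4 ^ 4 + C 36 * X 5 ^ 7 + C 49 * X 6 ^ 7)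
    (v : Spec (.of (MvPolynomial (Fin 7) k ⧸ Ideal.span (Set.range F))))
    (hvm : v.asIdeal = Ideal.span (Set.range fun j : Fin 7 => Ideal.Quotient.mk (Ideal.span (Set.range F)) (X j))) :
    ¬ FullCl p ((Spec (.of (MvPolynomial (Fin 7) k ⧸ Ideal.span (Set.range F)))).presheaf.stalk v) :=
  CINotFullAtMaximalIdeal.ci_not_fullCl_stalk_origin p k F (constantCoeff_F k F hF0 hF1 hF2)
    (prod_pow_mem_span_X_pow k F hF0 hF1 hF2 p (Fact.out : p.Prime).two_le) [X 3, X 4, X 5, X 6] (by simp [constantCoeff_X]) rfl 8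
    (sop_certificate k F hF0 hF1 hF2 h2) v hvm

/-! ## §3 ★★★ The registrar pairing for BED CI-2 -/

/-- ★★★ **ROW #12 / BED CI-2 (codimension 3, dimension 4), `p ≥ 11`, ANY field**: the vertex is NOT FULL, AND the point floor is CURED (`K := AlgebraicClosure k`).
[OURS · assembly of landed theorems] -/
theorem row12_CI2_germ (p : ℕ) [Fact p.Prime] (hp : 11 ≤ p) (k : Type) [Field k] [CharP k p]
    (F : Fin 3 → MvPolynomial (Fin 7) k)
    (hF0 : F 0 = X 0 ^ 2 + X 1 ^ 3 + X 2 ^ 5 + X 3 ^ 3 + X 4 ^ 4 + X 5 ^ 7 + X 6 ^ 7)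
    (hF1 : F 1 = X 0 ^ 2 + C 2 * X 1 ^ 3 + C 3 * X 2 ^ 5 + C 4 * X 3 ^ 3 + C 5 * X 4 ^ 4 + C 6 * X 5 ^ 7 + C 7 * X 6 ^ 7)
    (hF2 : F 2 = X 0 ^ 2 + C 4 * X 1 ^ 3 + C 9 * X 2 ^ 5 + C 16 * X 3 ^ 3 + C 25 * X 4 ^ 4 + C 36 * X 5 ^ 7 + C 49 * X 6 ^ 7)
    (v : Spec (.of (MvPolynomial (Fin 7) k ⧸ Ideal.span (Set.range F))))
    (hvm : v.asIdeal = Ideal.span (Set.range fun j : Fin 7 => Ideal.Quotient.mk (Ideal.span (Set.range F)) (X j))) :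
    ¬ FullCl p ((Spec (.of (MvPolynomial (Fin 7) k ⧸ Ideal.span (Set.range F)))).presheaf.stalk v) ∧
    ∀ (S' : Scheme.{0}) (gS : S' ⟶ Spec ((Spec (.of (MvPolynomial (Fin 7) k ⧸ Ideal.span (Set.range F)))).presheaf.stalk v)),
      IsBlowup gS ((affineBlowup.idealSheaf (Ideal.span (Set.range fun j : Fin 7 => Ideal.Quotient.mk (Ideal.span (Set.range F)) (X j)))).comap
        ((Spec (.of (MvPolynomial (Fin 7) k ⧸ Ideal.span (Set.range F)))).fromSpecStalk v)) →
      ∃ 𝓚 : S'.IdealSheafData, 𝓚 ≠ ⊥ ∧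
        (∀ s ∈ (𝓚.support : Set S'), gS.base s = closedPoint ((Spec (.of (MvPolynomial (Fin 7) k ⧸ Ideal.span (Set.range F)))).presheaf.stalk v)) ∧
        ∀ (S'' : Scheme.{0}) (π : S'' ⟶ S'), IsBlowup π 𝓚 → ∀ s : S'', FullCl p (S''.presheaf.stalk s) :=
  ⟨diagonalBPTriple_vertex_not_full p k (by exact_mod_cast DiagonalBPCIRow.natCast_ne_zero_of_lt (R := k) p 2 (by norm_num) (by omega)) F hF0 hF1 hF2 v hvm,
    diagonalBPTriple_pointFloorCured p hp k (AlgebraicClosure k) F hF0 hF1 hF2 v hvm⟩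

end Summit.ResolutionOfSingularities.ResolutionOfSingularities.Theorems.FInjectiveMacaulayfication.DiagonalBPTripleRow

end
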